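import Summits.BirchSwinnertonDyer.BirchSwinnertonDyer.Theses.AdditiveBranchIMC

/-!
# K1 route `AdditiveBranchIMC` — glue of the by-name alias split of `PrintedFacts`

Item `stmt-BirchSwinnertonDyer-19308` (support, glue of the alias split E2 of the input support
`PrintedFacts`, stmt-BirchSwinnertonDyer-19362):
`PrintedFactsOfParts := GreenbergVatsalNonPrimitiveDatumSelmer → GreenbergNoFiniteSubmodule →
GreenbergKummerImageGoodOrdinary → DelbourgoRankZeroDivisibility → RankEqAnalyticRankLeOne →
EntireLFunctionRat → ModularParametrizationSupply → BSDQuotientIsogenyInvariance → PrintedFacts`.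

The eight children are the eight conjuncts of `PrintedFacts` BY NAME, so the glue is the anonymous
constructor — the planner's pre-flight `planner/k1-staffable/AliasSketch.lean`
(`printedFactsOfParts_holds`) landed verbatim against the route declarations. No mathematics is
touched: the eight published facts stay exactly as unproved as before.
-/

set_option autoImplicit false
set_option linter.dupNamespace false

namespace Summit.BirchSwinnertonDyer.BirchSwinnertonDyer.Theorems.AdditiveBranchIMCPrintedFactsGlue

open Summit.BirchSwinnertonDyer.BirchSwinnertonDyer.Theses.AdditiveBranchIMC

/-- **Glue item 19308, proved outright**: the eight by-name conjuncts assemble to `PrintedFacts`. -/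
theorem printedFactsOfParts_proof : PrintedFactsOfParts :=
  fun h1 h2 h3 h4 h5 h6 h7 h8 ↦ ⟨h1, h2, h3, h4, h5, h6, h7, h8⟩

end Summit.BirchSwinnertonDyer.BirchSwinnertonDyer.Theorems.AdditiveBranchIMCPrintedFactsGlue
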